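import Summits.BirchSwinnertonDyer.BirchSwinnertonDyer.Theorems.ThetaPartnerAtTwoSignedControlAtTwoSignedEulerCharAssembly
import Literature.NumberTheory.EllipticCurves.Rank1Residual.Predicates
import Literature.NumberTheory.DiophantineGeometry.LocalReductionFiniteBadPlacesProofs
import Literature.NumberTheory.EllipticCurves.TamagawaSubgroupProofs
import Literature.NumberTheory.EllipticCurves.TamagawaFiniteIndexProofs
import Summits.BirchSwinnertonDyer.Rank1Residual.Additive.LocalTowerKernelCardEqTamagawaCyclotomic
import Summits.BirchSwinnertonDyer.Rank1Residual.P2.EmptyCellsAtTwo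
import Summits.BirchSwinnertonDyer.Rank1Residual.X5.RationalTwoTorsionPoints
import HarnessLib

/-!
# Kobayashi's `Sel^ε(E/ℚ_∞)`: `#ker g^ε ∣ p^{ord_p ∏ c_ℓ}` under «`r_p^ε` injective», and B. D. Kim's signed
# `Γ`-Euler characteristic at `2` (the registered stub of line `eulerchar`) DERIVED from two displayed inputs

Sequel of `…SignedControlAtTwoSignedEulerCharAssembly.lean` (Greenberg's Lemmas 3.2 / 4.3 at `n = 0` for
`Sel^ε`). Route `ThetaPartnerAtTwo` (TP2), crux K4 `SignedControlAtTwo` (stmt-BirchSwinnertonDyer-20309), line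
`eulerchar`, load-bearing stub `stub_signedEulerCharTwo` (= crux 19097 line `signed_halves_two` stub (2′)).
Seat `prover-bsd-wall-tp2-p3` (lead, LINE mode). HONEST FRAMING: THEOREMS ONLY (no definition, no named fact,
no `sorry`), route-independent; nothing about any curve is asserted beyond the displayed hypotheses; closes no
item by itself; BSD is not proved by any of this.

* §2 (`K = ℚ`, `κ` cyclotomic, any `p`, either sign): `natCard_signedKerG_dvd_pow_padicValNat_tamagawaProduct` —
  **`#(A^ε_0/Sel_0) ∣ p^{ord_p ∏_ℓ c_ℓ}`** PROVIDED every class of `A^ε_0 = h_0⁻¹(Sel^ε(E/ℚ_∞))` satisfies the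
  classical local condition at the place above `p` («`r_p^ε` injective», B. D. Kim's «`g_v` is injective because
  `E(F_v) ⊗ ℚ_p/ℤ_p = (∏ H^±_w)^Γ`»; displayed); Greenberg p. 88 count at the bad `ℓ ≠ p`
  (`Rank1Residual.Additive.natCard_localTowerKerPrimary_zero_eq_pow_of_isCyclotomic`), nothing at `∞`; and the
  one-sided count `#(Sel^ε_∞)^γ · #E[p^∞]^{Γ_ℚ} ∣ #Sel_{p^∞}(E/ℚ) · p^{ord_p ∏ c_ℓ}` from that input ALONE
  (`natCard_signedSelmerInvariants_mul_dvd_of_localInj`; no Poitou–Tate).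
* §3 (`p = 2`, `GoodSS W 2`, `ε = 1`): `signedEulerChar_two_of_localInj_of_count` — **the registered stub
  `stub_signedEulerCharTwo` FOLLOWS from two displayed inputs**: (INJ⁺@2) every class of `A⁺_0` is classically
  Selmer at `2`, and (COUNT⁺@2) `#(A⁺_0/Sel_0) · #E[2^∞]^{Γ_ℚ} = 2^{ord₂ ∏ c_ℓ} · #(Sel⁺_∞)_γ` (Greenberg's Lemmas
  4.4 + 4.7 READ AT `2` on `Sel⁺`); `#E[2^∞]^{Γ_ℚ} = 1` is a theorem at good supersingular `2`
  (`P2.irr_two_of_goodSS_two`); unit `u = 1`.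

What `p = 2` costs here: nothing — Lemma 3.2 holds for every `ℤ_p`-extension, `E(ℚ_∞)[2^∞]` is finite
(`finite_fixedPoints_kerSubgroup_geomPrimaryTorsion_rat`), `E(ℚ)[2] = 0` at good supersingular `2`; the two
displayed inputs carry the whole `p = 2` content (Kobayashi §§8–9 at `2` for INJ⁺; Cassels–Poitou–Tate and
`(Sel⁺_∞)_Γ = 0` for COUNT⁺ — B. D. Kim 2013 Cor. 3.15 / Thm. 3.14, printed for odd `p`).

References: [GreenbergLNM1716] §3 Lemma 3.3, p. 88; §4 Lemmas 4.3–4.7 (pp. 103–108); [BDKim2013] Thm. 1.1,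
Cor. 3.15 and its proof (pp. 199–200); [Kobayashi2003] Def. 1.1, Thm. 9.3; [Sprung2024] §5.2 (♯/♭ twin; template
credit K3 lane and `bsd-2adic-ss-1` GEN 11 `…FlatKerGCount`).
-/

set_option autoImplicit false
-- the Theorems namespace of this sub repeats the summit name by design (D-0017 nested layout)
set_option linter.dupNamespace false

noncomputable section

open scoped Classical NumberField

open NumberField IsDedekindDomain

universe u

namespace Summit.BirchSwinnertonDyer.BirchSwinnertonDyer.Theorems.SignedEC

open Literature.NumberTheory.EllipticCurves Literature.NumberTheory.GaloisRepresentations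
  WeierstrassCurve ZpExtension Literature.NumberTheory.EllipticCurves.Kobayashi2003
  Literature.NumberTheory.EllipticCurves.IwasawaDual Literature.NumberTheory.EllipticCurves.IwasawaAlgebra
  Literature.NumberTheory.EllipticCurves.Rank1Residual

/-! ## §2 Over `ℚ` along the cyclotomic `ℤ_p`-extension: `#(A^ε_0/Sel_0) ∣ p^{ord_p ∏_ℓ c_ℓ}` under «`r_p^ε` injective» -/

section Rat

variable (W : WeierstrassCurve ℚ) [W.IsElliptic] (p : ℕ) [Fact p.Prime] (ε : ℤˣ)

/-- **`#ker g^ε = #(A^ε_0/Sel_0)` divides `p^{ord_p ∏_ℓ c_ℓ}`** for Kobayashi's `Sel^ε(E/ℚ_∞)` along the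
CYCLOTOMIC `ℤ_p`-extension of `ℚ`, at ANY prime `p` and either sign, PROVIDED every class of
`A^ε_0 = h_0⁻¹(Sel^ε(E/ℚ_∞)) ⊆ H¹(ℚ, E[p^∞])` satisfies the classical local condition at the place above `p`
(«`r_p^ε` injective» — B. D. Kim, proof of Cor. 3.15: «If `v ∣ p`, `g_v` is injective because
`E(F_v) ⊗ ℚ_p/ℤ_p = (∏_{w∣v} H^±_w)^Γ`», the `±` local theory; displayed hypothesis `hinj`). Chain:
`#ker g^ε ∣ ∏_{bad ℓ ≠ p} #𝒦_{ℓ,0}[p^∞]` (§1) `= ∏ p^{ord_p c_ℓ}` (Greenberg p. 88, kernel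
`Rank1Residual.Additive.natCard_localTowerKerPrimary_zero_eq_pow_of_isCyclotomic`) `∣ ∏_ℓ c_ℓ`; a `p`-power
dividing `∏ c_ℓ` divides `p^{ord_p ∏ c_ℓ}`. No archimedean term (the archimedean conditions of the tree's
Selmer groups at layer `0` and over `ℚ_∞` coincide class by class, `ℚ_∞` totally real). The divisibility
HALF of Kim's count `|ker g| ∼ ∏ c_v` — free of Poitou–Tate.
[cite: BDKim2013, proof of Cor. 3.15 (pp. 199–200)] [cite: GreenbergLNM1716, §4 p. 104 and §3 Lemma 3.3, p. 88] -/
theorem natCard_signedKerG_dvd_pow_padicValNat_tamagawaProduct {κ : ZpExtension ℚ p} (hκ : κ.IsCyclotomic)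
    (hinj : ∀ v : HeightOneSpectrum (𝓞 ℚ), (p : 𝓞 ℚ) ∈ v.asIdeal →
      ∀ y ∈ (signedSelmerInfty W κ ε).comap (W.layerToInfty κ 0),
        W.localResOver p (κ.layerSubgroup 0) (v.adicCompletion ℚ) y = 0) :
    Nat.card (↥((signedSelmerInfty W κ ε).comap (W.layerToInfty κ 0)) ⧸
      (W.selmerLayer κ 0).addSubgroupOf ((signedSelmerInfty W κ ε).comap (W.layerToInfty κ 0))) ∣
      p ^ padicValNat p W.tamagawaProduct := by
  -- the finite set of bad places not above `p`
  have hbad : (W.badPlaces (𝓞 ℚ)).Finite := W.finite_badPlaces_holds (𝓞 ℚ)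
  let B : Finset (HeightOneSpectrum (𝓞 ℚ)) := hbad.toFinset
  let S : Finset (HeightOneSpectrum (𝓞 ℚ)) := B.filter fun w ↦ (p : 𝓞 ℚ) ∉ w.asIdeal
  have hB : ∀ w : HeightOneSpectrum (𝓞 ℚ), w ∈ B ↔ ¬ W.HasGoodReductionAt w := fun w ↦ by
    simp only [B, Set.Finite.mem_toFinset, WeierstrassCurve.badPlaces, Set.mem_setOf_eq]
  have hS : ∀ w : HeightOneSpectrum (𝓞 ℚ), w ∈ S ↔ ¬ W.HasGoodReductionAt w ∧ (p : 𝓞 ℚ) ∉ w.asIdeal :=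
    fun w ↦ by rw [Finset.mem_filter, hB]
  have hS' : ∀ w : HeightOneSpectrum (𝓞 ℚ), w ∉ S → (p : 𝓞 ℚ) ∉ w.asIdeal → W.HasGoodReductionAt w := by
    intro w hw hpw
    by_contra hng
    exact hw ((hS w).mpr ⟨hng, hpw⟩)
  -- `#ker g^ε ∣ ∏_{w ∈ S} #𝒦_{w,0}[p^∞]`
  have h1 := natCard_signedKerG_dvd_prod_natCard_localTowerKerPrimary W κ ε hinj S hS'
  -- `∏_{w ∈ S} #𝒦_{w,0}[p^∞] = p^{∑ ord_p c_w}` (Greenberg p. 88, kernel)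
  have h2 : ∏ w ∈ S, Nat.card (W.localTowerKerPrimary κ (w.adicCompletion ℚ) 0) =
      p ^ ∑ w ∈ S, padicValNat p
        ((W.baseChange (w.adicCompletion ℚ)).localTamagawaNumber (w.adicCompletionIntegers ℚ)) := by
    rw [← Finset.prod_pow_eq_pow_sum]
    refine Finset.prod_congr rfl fun w hw ↦ ?_
    exact Summit.BirchSwinnertonDyer.Rank1Residual.Additive.natCard_localTowerKerPrimary_zero_eq_pow_of_isCyclotomic
      W hκ ((hS w).mp hw).2
  -- `∏_{w ∈ S} #𝒦_{w,0}[p^∞] ∣ ∏_{w ∈ S} c_w ∣ ∏_v c_v`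
  have h3 : ∏ w ∈ S, Nat.card (W.localTowerKerPrimary κ (w.adicCompletion ℚ) 0) ∣
      ∏ w ∈ S, (W.baseChange (w.adicCompletion ℚ)).localTamagawaNumber (w.adicCompletionIntegers ℚ) := by
    refine Finset.prod_dvd_prod_of_dvd _ _ fun w hw ↦ ?_
    rw [Summit.BirchSwinnertonDyer.Rank1Residual.Additive.natCard_localTowerKerPrimary_zero_eq_pow_of_isCyclotomic
      W hκ ((hS w).mp hw).2]
    exact pow_padicValNat_dvd
  have hsupp : (Function.mulSupport fun w : HeightOneSpectrum (𝓞 ℚ) ↦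
      (W.baseChange (w.adicCompletion ℚ)).localTamagawaNumber (w.adicCompletionIntegers ℚ)) ⊆ ↑B := by
    intro w hw
    rw [Finset.mem_coe, hB]
    intro hgw
    exact hw (W.localTamagawaNumber_eq_one_of_hasGoodReductionAt_holds w hgw)
  have h4 : ∏ w ∈ S, (W.baseChange (w.adicCompletion ℚ)).localTamagawaNumber (w.adicCompletionIntegers ℚ) ∣
      W.tamagawaProduct := by
    rw [WeierstrassCurve.tamagawaProduct, finprod_eq_prod_of_mulSupport_subset _ hsupp]
    exact Finset.prod_dvd_prod_of_subset S B _ (Finset.filter_subset _ B)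
  -- a `p`-power dividing `∏_v c_v ≠ 0` divides `p^{ord_p ∏_v c_v}`
  have hk : _ ∣ p ^ _ := h2 ▸ h1
  obtain ⟨j, -, hj⟩ := (Nat.dvd_prime_pow (Fact.out : p.Prime)).mp hk
  rw [hj] at h1 ⊢
  exact pow_dvd_pow p ((padicValNat_dvd_iff_le W.tamagawaProduct_pos'.ne').mp (h1.trans (h3.trans h4)))

/-- **The one-sided signed count from «`r_p^ε` injective» ALONE** (any `p`, cyclotomic `κ`, topological
generator `γ`, either sign): if `Sel_{p^∞}(E/ℚ)` is finite then `A^ε_0`, `(Sel^ε_∞)^γ` are finite and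
**`#(Sel^ε_∞)^γ · #E[p^∞]^{Γ_ℚ} ∣ #Sel_{p^∞}(E/ℚ) · p^{ord_p ∏ c_ℓ}`** — Lemma 4.3 for `Sel^ε` times the
divisibility `#ker g^ε ∣ p^{ord_p ∏ c_ℓ}`; the inequality `ord_p #(Sel^ε_∞)^Γ ≤ ord_p #Sel + ord_p ∏ c_ℓ` that
the Eisenstein (lower) half of a signed main-conjecture argument consumes, with NO Poitou–Tate input.
[cite: BDKim2013, proof of Cor. 3.15 (pp. 199–200)] [cite: GreenbergLNM1716, §4 Lemmas 4.3–4.4 (pp. 103–104)] -/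
theorem natCard_signedSelmerInvariants_mul_dvd_of_localInj {κ : ZpExtension ℚ p} (hκ : κ.IsCyclotomic)
    {γ : Field.absoluteGaloisGroup ℚ} (hγ : κ.IsTopGenerator γ)
    (hinj : ∀ v : HeightOneSpectrum (𝓞 ℚ), (p : 𝓞 ℚ) ∈ v.asIdeal →
      ∀ y ∈ (signedSelmerInfty W κ ε).comap (W.layerToInfty κ 0),
        W.localResOver p (κ.layerSubgroup 0) (v.adicCompletion ℚ) y = 0)
    (hfin : Finite (W.selmerGroupPInfty p)) :
    Finite ↥(endInvariants (conjSignedSelmerInfty W κ ε γ - 1)) ∧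
      Nat.card ↥(endInvariants (conjSignedSelmerInfty W κ ε γ - 1)) *
          Nat.card (MulAction.fixedPoints (Field.absoluteGaloisGroup ℚ) (W.geomPrimaryTorsion p)) ∣
        Nat.card ↥(W.selmerGroupPInfty p) * p ^ padicValNat p W.tamagawaProduct := by
  haveI := W.finite_fixedPoints_kerSubgroup_geomPrimaryTorsion_rat κ (p := p)
  have hkerg := finite_signedKerG_of_localResOver_eq_zero W κ ε hinj
  have hA := finite_comap_layerToInfty_signedSelmerInfty_of_finite W κ ε hfin hkerg
  refine ⟨finite_endInvariants_conjSignedSelmerInfty_of_finite_comap W κ ε hγ hA, ?_⟩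
  rw [natCard_signedSelmerInvariants_mul_natCard_fixedPoints W κ ε hγ]
  exact mul_dvd_mul_left _ (natCard_signedKerG_dvd_pow_padicValNat_tamagawaProduct W p ε hκ hinj)

end Rat

/-! ## §3 `p = 2`, `GoodSS W 2`, `ε = 1`: the registered stub from INJ⁺@2 and COUNT⁺@2 -/

section Two

variable (W : WeierstrassCurve ℚ) [W.IsElliptic] [W.IsGloballyMinimal]

/-- **`#E[2^∞]^{Γ_ℚ} = 1` at a good supersingular `2`**: `E[2]` is irreducible (`P2.irr_two_of_goodSS_two`:
a rational `2`-torsion point reduces to a point of order `2` of `Ẽ(𝔽₂)`, which has `1 + 2 − a₂ = 3` or odd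
order), so `E(ℚ)[2] = 0` (`irr_two_iff_forall_two_nsmul`) and the binder of
`natCard_fixedPoints_absoluteGaloisGroup_geomPrimaryTorsion_eq_one` holds (the two group laws on `E(ℚ)`
differ by the `DecidableEq ℚ` instance only). [cite: GreenbergLNM1716, §4 Lemma 4.3 (p. 103)] -/
theorem natCard_fixedPoints_geomPrimaryTorsion_two_eq_one (hss : GoodSS W 2) :
    Nat.card (MulAction.fixedPoints (Field.absoluteGaloisGroup ℚ) (W.geomPrimaryTorsion 2)) = 1 := by
  refine W.natCard_fixedPoints_absoluteGaloisGroup_geomPrimaryTorsion_eq_one (p := 2) fun P hP ↦ ?_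
  have h := (Summit.BirchSwinnertonDyer.Rank1Residual.X5.O1.irr_two_iff_forall_two_nsmul W).mp
    (Summit.BirchSwinnertonDyer.Rank1Residual.P2.irr_two_of_goodSS_two W hss) P
  apply h
  convert hP

/-- **The registered stub `stub_signedEulerCharTwo` of line `eulerchar` (crux K4 `SignedControlAtTwo`,
stmt-BirchSwinnertonDyer-20309; = crux 19097 line `signed_halves_two` stub (2′)) FROM TWO DISPLAYED INPUTS.**
For `W/ℚ` elliptic, globally minimal, good supersingular at `2`, any `ℤ₂`-extension `κ` of `ℚ` that is the
cyclotomic one, any topological generator `γ`, IF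
* (INJ⁺@2, «`r₂⁺` injective» on the classes of `H¹(ℚ, E[2^∞])`) every `y ∈ A⁺_0 = h_0⁻¹(Sel⁺(E/ℚ_∞))` satisfies
  the classical local condition at the place above `2` — B. D. Kim, proof of Cor. 3.15: «If `v ∣ p`, `g_v` is
  injective because `E(F_v) ⊗ ℚ_p/ℤ_p = (∏_{w∣v} H^±_w)^Γ`» (Kobayashi §§8–9 / Kim 2007 Prop. 4.28, printed for
  odd `p`; READ AT `2`), and
* (COUNT⁺@2) `Sel_{2^∞}(E/ℚ)` finite and `(Sel⁺_∞)_γ` finite ⇒ `#(A⁺_0/Sel_0) · #E[2^∞]^{Γ_ℚ} = 2^{ord₂ ∏ c_ℓ} · #(Sel⁺_∞)_γ`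
  — Greenberg's Lemmas 4.4 + 4.7 for `Sel⁺` at `2` (Cassels–Poitou–Tate count `#ker g = 2^{ord₂ ∏ c_ℓ}` and
  Kim's Thm. 3.14 `(Sel⁺_∞)_Γ = 0`; READ AT `2`),
THEN `Sel_{2^∞}(E/ℚ)` finite ⇒ `(Sel⁺_∞)^γ` finite and
**`#(Sel⁺_∞)^γ = u · 2^{ord₂ ∏ c_ℓ} · #Sel_{2^∞}(E/ℚ) · #(Sel⁺_∞)_γ`** in `ℚ₂` (with `u = 1`). Kernel steps:
INJ⁺ ⇒ `ker g⁺` finite ⇒ `A⁺_0` finite ⇒ `(Sel⁺_∞)^γ` finite (Lemma 3.2) ⇒ `X⁺` torsion, `(Sel⁺_∞)_γ` finite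
(dual pair); Lemma 4.3 for `Sel⁺`; `#E[2^∞]^{Γ_ℚ} = 1`; multiply. [cite: BDKim2013, Thm. 1.1 and Cor. 3.15 (pp. 199–200)]
[cite: GreenbergLNM1716, §4 Lemmas 4.3, 4.4, 4.7 (pp. 103–108)] [cite: Kobayashi2003, Thm. 9.3] -/
theorem signedEulerChar_two_of_localInj_of_count (hss : GoodSS W 2) (κ : ZpExtension ℚ 2)
    {γ : Field.absoluteGaloisGroup ℚ} (hγ : κ.IsTopGenerator γ)
    (hinj : ∀ v : HeightOneSpectrum (𝓞 ℚ), (2 : 𝓞 ℚ) ∈ v.asIdeal →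
      ∀ y ∈ (signedSelmerInfty W κ 1).comap (W.layerToInfty κ 0),
        W.localResOver 2 (κ.layerSubgroup 0) (v.adicCompletion ℚ) y = 0)
    (hcount : Finite (W.selmerGroupPInfty 2) → Finite (EndCoinvariants (conjSignedSelmerInfty W κ 1 γ - 1)) →
      Nat.card (↥((signedSelmerInfty W κ 1).comap (W.layerToInfty κ 0)) ⧸
          (W.selmerLayer κ 0).addSubgroupOf ((signedSelmerInfty W κ 1).comap (W.layerToInfty κ 0))) *
        Nat.card (MulAction.fixedPoints (Field.absoluteGaloisGroup ℚ) (W.geomPrimaryTorsion 2)) =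
      2 ^ padicValNat 2 W.tamagawaProduct * Nat.card (EndCoinvariants (conjSignedSelmerInfty W κ 1 γ - 1)))
    (hfin : Finite (W.selmerGroupPInfty 2)) :
    Finite (endInvariants (conjSignedSelmerInfty W κ 1 γ - 1)) ∧
      ∃ u : ℤ_[2]ˣ, (Nat.card (endInvariants (conjSignedSelmerInfty W κ 1 γ - 1)) : ℚ_[2]) =
        ((u : ℤ_[2]) : ℚ_[2]) * ((2 : ℕ) : ℚ_[2]) ^ (padicValNat 2 W.tamagawaProduct) *
          (Nat.card (W.selmerGroupPInfty 2) : ℚ_[2]) *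
            (Nat.card (EndCoinvariants (conjSignedSelmerInfty W κ 1 γ - 1)) : ℚ_[2]) := by
  -- `E(ℚ_∞)[2^∞]` is finite; `#E[2^∞]^{Γ_ℚ} = 1`
  haveI := W.finite_fixedPoints_kerSubgroup_geomPrimaryTorsion_rat κ (p := 2)
  have htors := natCard_fixedPoints_geomPrimaryTorsion_two_eq_one W hss
  -- INJ⁺ ⇒ `ker g⁺` finite ⇒ `A⁺_0` finite ⇒ `(Sel⁺_∞)^γ` finite
  have hkerg := finite_signedKerG_of_localResOver_eq_zero W κ 1 hinj
  have hA := finite_comap_layerToInfty_signedSelmerInfty_of_finite W κ 1 hfin hkerg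
  have hfinΓ : Finite ↥(endInvariants (conjSignedSelmerInfty W κ 1 γ - 1)) :=
    finite_endInvariants_conjSignedSelmerInfty_of_finite_comap W κ 1 hγ hA
  -- the dual pair: `X⁺` torsion, `(Sel⁺_∞)_γ` finite
  let D : SignedSelmerDualData W κ γ 1 := signedSelmerDualData W κ 1 hγ
  haveI := D.moduleFinite hγ
  have htor : Module.IsTorsion (IwasawaAlgebra 2) D.X := D.isTorsion_of_finite_endInvariants hγ hfinΓ
  have hfinC : Finite (EndCoinvariants (conjSignedSelmerInfty W κ 1 γ - 1)) :=
    (D.isDualPair hγ).finite_endCoinvariants_of_finite htor hfinΓ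
  refine ⟨hfinΓ, 1, ?_⟩
  -- Lemma 4.3 for `Sel⁺` and the count
  have h43 := natCard_signedSelmerInvariants_mul_natCard_fixedPoints W κ 1 hγ
  have hc := hcount hfin hfinC
  rw [htors, mul_one] at h43 hc
  rw [h43, hc, Units.val_one, PadicInt.coe_one, one_mul]
  push_cast
  ring

/-! ### COUNT⁺@2 unpacked: Cassels' count at layer `0` ∧ trivial coinvariants (Greenberg p. 104) -/

omit [W.IsElliptic] [W.IsGloballyMinimal] in
/-- The arithmetic of Greenberg's remark (LNM 1716 p. 104): if `k ∣ 2^t` and `s ≥ 1`, then `k = 2^t · s` iff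
`k = 2^t` and `s = 1`. [folklore] -/
theorem eq_pow_mul_iff_of_dvd {k t s : ℕ} (hk : k ∣ 2 ^ t) (hs : 0 < s) :
    k = 2 ^ t * s ↔ k = 2 ^ t ∧ s = 1 := by
  constructor
  · intro h
    have hpt : 0 < 2 ^ t := pow_pos two_pos t
    have hle : k ≤ 2 ^ t := Nat.le_of_dvd hpt hk
    have hs1 : s ≤ 1 := by
      have hmul : 2 ^ t * s ≤ 2 ^ t * 1 := by rw [mul_one, ← h]; exact hle
      exact Nat.le_of_mul_le_mul_left hmul hpt
    have hs' : s = 1 := le_antisymm hs1 hs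
    subst hs'
    exact ⟨by rw [h, mul_one], rfl⟩
  · rintro ⟨rfl, rfl⟩
    rw [mul_one]

/-- **COUNT⁺@2 UNPACKED (Greenberg, LNM 1716 p. 104, verbatim «by Cassels' theorem, `ker(g) = ker(r)` … theorem
4.1 is equivalent to asserting that `(Sel_E(F_∞)_p)_Γ = 0`»), for Kobayashi's `Sel⁺` at `2`.** For `W/ℚ` good
supersingular at `2`, the CYCLOTOMIC `ℤ₂`-extension `κ`, a topological generator `γ`, and given INJ⁺@2, the count
COUNT⁺@2 — `Sel_{2^∞}(E/ℚ)` finite → `(Sel⁺_∞)_γ` finite → `#ker g⁺ · #E[2^∞]^{Γ_ℚ} = 2^{ord₂ ∏ c_ℓ} · #(Sel⁺_∞)_γ` —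
holds IF AND ONLY IF, under the same premises, BOTH `#ker g⁺ = 2^{ord₂ ∏ c_ℓ}` (CASSELS⁺@0: every class of
`⊕_ℓ ker(r_ℓ)` is reached by a global class; Greenberg Prop. 4.13 / Cassels 1964, Poitou–Tate over `ℚ`) AND
`#(Sel⁺_∞)_γ = 1` (COINV⁺@2: `X⁺(E/ℚ_∞)` has no nonzero finite `Λ`-submodule; B. D. Kim 2013 Thm. 1.1 / 3.14
at odd `p`). From §2 (`#ker g⁺ ∣ 2^{ord₂ ∏ c_ℓ}`) no other solution exists.
[cite: GreenbergLNM1716, §4 p. 104 and Lemma 4.7, Prop. 4.8 (pp. 107–109)] [cite: BDKim2013, Thm. 1.1 and Thm. 3.14] -/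
theorem signedCountTwo_iff_kerG_eq_and_coinvariants_eq_one (hss : GoodSS W 2) {κ : ZpExtension ℚ 2}
    (hκ : κ.IsCyclotomic) (γ : Field.absoluteGaloisGroup ℚ)
    (hinj : ∀ v : HeightOneSpectrum (𝓞 ℚ), (2 : 𝓞 ℚ) ∈ v.asIdeal →
      ∀ y ∈ (signedSelmerInfty W κ 1).comap (W.layerToInfty κ 0),
        W.localResOver 2 (κ.layerSubgroup 0) (v.adicCompletion ℚ) y = 0) :
    (Finite (W.selmerGroupPInfty 2) → Finite (EndCoinvariants (conjSignedSelmerInfty W κ 1 γ - 1)) →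
      Nat.card (↥((signedSelmerInfty W κ 1).comap (W.layerToInfty κ 0)) ⧸
          (W.selmerLayer κ 0).addSubgroupOf ((signedSelmerInfty W κ 1).comap (W.layerToInfty κ 0))) *
        Nat.card (MulAction.fixedPoints (Field.absoluteGaloisGroup ℚ) (W.geomPrimaryTorsion 2)) =
      2 ^ padicValNat 2 W.tamagawaProduct * Nat.card (EndCoinvariants (conjSignedSelmerInfty W κ 1 γ - 1))) ↔
    (Finite (W.selmerGroupPInfty 2) → Finite (EndCoinvariants (conjSignedSelmerInfty W κ 1 γ - 1)) →
      Nat.card (↥((signedSelmerInfty W κ 1).comap (W.layerToInfty κ 0)) ⧸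
          (W.selmerLayer κ 0).addSubgroupOf ((signedSelmerInfty W κ 1).comap (W.layerToInfty κ 0))) =
        2 ^ padicValNat 2 W.tamagawaProduct ∧
      Nat.card (EndCoinvariants (conjSignedSelmerInfty W κ 1 γ - 1)) = 1) := by
  have hdvd := natCard_signedKerG_dvd_pow_padicValNat_tamagawaProduct W 2 1 hκ hinj
  have htors := natCard_fixedPoints_geomPrimaryTorsion_two_eq_one W hss
  refine ⟨fun h hfin hco ↦ ?_, fun h hfin hco ↦ ?_⟩
  · have hcount := h hfin hco
    rw [htors, mul_one] at hcount
    haveI := hco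
    exact (eq_pow_mul_iff_of_dvd hdvd Nat.card_pos).mp hcount
  · obtain ⟨hk, hs⟩ := h hfin hco
    rw [htors, hk, hs]

omit [W.IsElliptic] in
/-- **COUNT⁺@2 from the two named residues** (any `ℤ₂`-extension, any `γ`; the shape of a split stub): at a
good supersingular `2` (`#E(ℚ)[2^∞] = 1` automatic), CASSELS⁺@0 in count form (`Sel_{2^∞}(E/ℚ)` finite ⇒
`#ker g⁺ = 2^{ord₂ ∏ c_ℓ}`) and COINV⁺@2 (`Sel` finite ⇒ `(Sel⁺_∞)_γ` finite ⇒ `#(Sel⁺_∞)_γ = 1`) give COUNT⁺@2.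
Pure bookkeeping. [cite: GreenbergLNM1716, §4 Lemma 4.7 (p. 107) and p. 104] -/
theorem signedCountTwo_of_cassels_of_coinv [W.IsElliptic] (hss : GoodSS W 2) (κ : ZpExtension ℚ 2)
    (γ : Field.absoluteGaloisGroup ℚ)
    (hCassels : Finite (W.selmerGroupPInfty 2) →
      Nat.card (↥((signedSelmerInfty W κ 1).comap (W.layerToInfty κ 0)) ⧸
          (W.selmerLayer κ 0).addSubgroupOf ((signedSelmerInfty W κ 1).comap (W.layerToInfty κ 0))) =
        2 ^ padicValNat 2 W.tamagawaProduct)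
    (hCoinv : Finite (W.selmerGroupPInfty 2) → Finite (EndCoinvariants (conjSignedSelmerInfty W κ 1 γ - 1)) →
      Nat.card (EndCoinvariants (conjSignedSelmerInfty W κ 1 γ - 1)) = 1) :
    Finite (W.selmerGroupPInfty 2) → Finite (EndCoinvariants (conjSignedSelmerInfty W κ 1 γ - 1)) →
      Nat.card (↥((signedSelmerInfty W κ 1).comap (W.layerToInfty κ 0)) ⧸
          (W.selmerLayer κ 0).addSubgroupOf ((signedSelmerInfty W κ 1).comap (W.layerToInfty κ 0))) *
        Nat.card (MulAction.fixedPoints (Field.absoluteGaloisGroup ℚ) (W.geomPrimaryTorsion 2)) =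
      2 ^ padicValNat 2 W.tamagawaProduct * Nat.card (EndCoinvariants (conjSignedSelmerInfty W κ 1 γ - 1)) := by
  intro hfin hco
  rw [natCard_fixedPoints_geomPrimaryTorsion_two_eq_one W hss, hCassels hfin, hCoinv hfin hco]

/-- **The registered stub `stub_signedEulerCharTwo` from THREE displayed inputs: INJ⁺@2, CASSELS⁺@0 (count form)
and COINV⁺@2** — the composition `signedEulerChar_two_of_localInj_of_count ∘ signedCountTwo_of_cassels_of_coinv`
(the shape of the v3 reshape of line `eulerchar`: CASSELS⁺@0 ⟸ Greenberg's Prop. 4.13 «Cassels' theorem»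
`Greenberg1999.casselsSurjectivity_H1Sigma ℚ` BY NAME + INJ⁺@2 + kernel; COINV⁺@2 ⟸ Prop. 4.12
`Greenberg1999.prop412_noFiniteSubmodule_H1Sigma_of_rank_one` BY NAME + the `Λ`-corank-one count + local lifts).
[cite: GreenbergLNM1716, §4 Lemmas 4.3–4.7, Props. 4.8, 4.12, 4.13] [cite: BDKim2013, Thm. 1.1, Cor. 3.15] -/
theorem signedEulerChar_two_of_localInj_of_cassels_of_coinv (hss : GoodSS W 2) (κ : ZpExtension ℚ 2)
    {γ : Field.absoluteGaloisGroup ℚ} (hγ : κ.IsTopGenerator γ)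
    (hinj : ∀ v : HeightOneSpectrum (𝓞 ℚ), (2 : 𝓞 ℚ) ∈ v.asIdeal →
      ∀ y ∈ (signedSelmerInfty W κ 1).comap (W.layerToInfty κ 0),
        W.localResOver 2 (κ.layerSubgroup 0) (v.adicCompletion ℚ) y = 0)
    (hCassels : Finite (W.selmerGroupPInfty 2) →
      Nat.card (↥((signedSelmerInfty W κ 1).comap (W.layerToInfty κ 0)) ⧸
          (W.selmerLayer κ 0).addSubgroupOf ((signedSelmerInfty W κ 1).comap (W.layerToInfty κ 0))) =
        2 ^ padicValNat 2 W.tamagawaProduct)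
    (hCoinv : Finite (W.selmerGroupPInfty 2) → Finite (EndCoinvariants (conjSignedSelmerInfty W κ 1 γ - 1)) →
      Nat.card (EndCoinvariants (conjSignedSelmerInfty W κ 1 γ - 1)) = 1)
    (hfin : Finite (W.selmerGroupPInfty 2)) :
    Finite (endInvariants (conjSignedSelmerInfty W κ 1 γ - 1)) ∧
      ∃ u : ℤ_[2]ˣ, (Nat.card (endInvariants (conjSignedSelmerInfty W κ 1 γ - 1)) : ℚ_[2]) =
        ((u : ℤ_[2]) : ℚ_[2]) * ((2 : ℕ) : ℚ_[2]) ^ (padicValNat 2 W.tamagawaProduct) *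
          (Nat.card (W.selmerGroupPInfty 2) : ℚ_[2]) *
            (Nat.card (EndCoinvariants (conjSignedSelmerInfty W κ 1 γ - 1)) : ℚ_[2]) :=
  signedEulerChar_two_of_localInj_of_count W hss κ hγ hinj
    (signedCountTwo_of_cassels_of_coinv W hss κ γ hCassels hCoinv) hfin

end Two

end Summit.BirchSwinnertonDyer.BirchSwinnertonDyer.Theorems.SignedEC

end
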